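import Summits.CriticalPhenomena.Ising3D.Control2DConvergenceRate
import Mathlib.Analysis.Calculus.Deriv.Slope
import Mathlib.Analysis.SpecialFunctions.Pow.Deriv
import Mathlib.Tactic.Linarith
import Mathlib.Tactic.Positivity
import Mathlib.Tactic.FieldSimp
import Mathlib.Tactic.Ring
import HarnessLib

/-!
# The crossing-symmetric value is bounded by the gap: `1 ≤ G(½,½) ≤ τ₀/(τ₀ - 2Δ_σ)` for every unitary typed solution with all
# labels `Δ_i ≥ τ₀ > 2Δ_σ`; E.1n's density and rate constants become universal under a gap
(cell `pub-ising3x`, seat controls-1 gen 44; PAPER §6.2 / Appendix E — CONTROL-ONLY; sequel to `Control2DFourPointBounds` (gen 42) and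
`Control2DConvergenceRate` (gen 44))

HONEST FRAMING: lottery ticket; floor = tightest certified 3D Ising CFT bounds; no exact-solution
claim without a proof. CONTROL-ONLY (`d = 2`, global `sl(2) × sl(2)` blocks, `Δ_σ = s` an INPUT, axiom set
`A2D′`); nothing here is about `d = 3`, no certificate, functional or number of the record is touched, and no
new hypothesis or named fact enters.

WHAT THIS FILE ADDS. `Control2DConvergenceRate` (E.1n) bounded the integrated weighted spectral density and the OPE tail of every unitary
solution of the typed sum rule at `Δ_σ = s > 0` with ONE datum-dependent constant, the crossing-symmetric value `G(½,½)`. Under a uniform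
lower bound `Δ_i ≥ τ₀ > 2s` on the exchanged dimensions (a scalar gap `U > 2s` with `s < 1`; every class of the record) that constant is
itself bounded: gen 42's closed envelope `fourPoint_diag_upper_closed` gives `G(y,y) ≤ 1 + (1 - ρ^{2s})/(ρ^{2s} - ρ^{τ₀})`, `ρ = (1-y)/y`,
at EVERY `y ∈ (½,1)`, monotonicity (`fourPoint_mono`) gives `G(½,½) ≤ G(y,y)`, and the envelope's limit as `ρ → 1⁻` is computed in the
kernel from the DERIVATIVES of `ρ ↦ ρ^{2s}`, `ρ ↦ ρ^{τ₀}` at `ρ = 1` (Mathlib `Real.hasDerivAt_rpow_const`, slopes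
`(ρ^c - 1)/(ρ - 1) → c`): `(1 - ρ^{2s})/(ρ^{2s} - ρ^{τ₀}) → 2s/(τ₀ - 2s)`. Hence:

* `tendsto_slope_rpow_one (c) : (ρ^c - 1)/(ρ - 1) → c` (`ρ → 1⁻`); `tendsto_envelope (hab : a < b) : (1 - ρ^a)/(ρ^a - ρ^b) → a/(b - a)`;
* **`CrossingData.fourPoint_half_le_of_lowerBound (hU) (hC) (hτ : ∀ i, τ₀ ≤ Δ_i) (hτ₀ : 2s < τ₀) : G(½,½) ≤ τ₀/(τ₀ - 2s)`** (and
  `1 ≤ G(½,½)`, `one_le_fourPoint`); branches `_of_hasScalarGap` (`τ₀ = min U 2`), `_of_location`;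
* the constants of E.1n made UNIVERSAL under the lower bound: **`sum_p_low_le_of_lowerBound`** —
  `Σ'_{Δ_i ≤ E} p_i ≤ ½ e^{2s} (E/(2s))^{2s} · τ₀/(τ₀ - 2s)` (`E ≥ 2s`), **`tail_le_of_lowerBound`** —
  `Σ'_{Δ_i ≥ E} p_i g_i(x₀,x₀) ≤ e^{2s} (E/(2s))^{2s} · τ₀/(τ₀ - 2s) · x₀^E`;
* at `Δ_σ = 1/8` on the record's class (all labels `≥ 0.99` by `twoSided_2d_kernel099`): **`record_fourPoint_half_le_sharp (w) : G(½,½) ≤ 99/74`**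
  (vs E.1n's `7/3`), `record_sum_p_low_le_sharp (w) : Σ'_{Δ_i ≤ E} p_i ≤ (99/148) e^{1/4} (4E)^{1/4}`; for a 2D-Ising-like gap `τ₀ = 1`
  at `s = 1/8`: `G(½,½) ≤ 4/3` (`fourPoint_half_le_ising_gap`).

MECHANISM, in one sentence: the closed envelope of E.1i at every `y ∈ (½,1)` + monotonicity `fourPoint_mono`, then the limit `ρ → 1⁻`
from the two derivative slopes at `ρ = 1` and `ge_of_tendsto` — no continuity of `G` is needed; the arithmetic
`1 + 2s/(τ₀ - 2s) = τ₀/(τ₀ - 2s)` is stated once, in `fourPoint_half_le_of_lowerBound`. The statements are about the typed class under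
the explicit gap hypothesis `∀ i, τ₀ ≤ Δ_i` with `2s < τ₀`; nothing about any CFT or `d = 3`.

NOT claimed: sharpness of `τ₀/(τ₀ - 2s)`; anything at `τ₀ ≤ 2s` (no uniform bound on `G(½,½)` over that class is asserted either way);
continuity of `G` (not needed: monotonicity and a limit of the closed-form envelope suffice); anything off the real diagonal; Virasoro;
anything three-dimensional; any new bound on `Δ_ε`, `c` or `λ²`; no number of the record touched beyond the `0.99` location theorem.

References: R. Rattazzi, V. S. Rychkov, E. Tonni, A. Vichi, JHEP 12 (2008) 031, §3 [cite: RattazziEtAl2008, §3]; D. Pappadopulo,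
S. Rychkov, J. Espin, R. Rattazzi, Phys. Rev. D 86 (2012) 105043, §4.2 [cite: PappadopuloRychkovEspinRattazzi2012PRD, §4.2]; F. A. Dolan,
H. Osborn, Nucl. Phys. B 678 (2004) 491, §3 [cite: DolanOsborn2004, §3]. Tree: `fourPoint_diag_upper_closed`, `fourPoint_mono`
(`Control2DFourPointBounds`); `opeConvergent_of_lowerBound`, `one_le_fourPoint`, `lowerBound_of_location` (`Control2DFourPoint`);
`lowerBound_of_hasScalarGap` (`Control2DTaylorTermwise`); `sum_p_low_le`, `tail_le` (`Control2DConvergenceRate`); `twoSided_2d_kernel099`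
(the record). Mathlib: `Real.hasDerivAt_rpow_const`, `hasDerivAt_iff_tendsto_slope_left_right`, `slope_def_field`, `ge_of_tendsto`,
`Ioo_mem_nhdsLT`.
-/

namespace Summit.CriticalPhenomena.Ising3D.Control2D

open Set Filter Topology
open Literature.MathematicalPhysics.QuantumFieldTheory.ConformalBootstrap3D

/-! ### The limit of the closed-form envelope at the crossing-symmetric point -/

/-- **The slope of `ρ ↦ ρ^c` at `1`**: `(ρ^c - 1)/(ρ - 1) → c` as `ρ → 1⁻` (the derivative `c · 1^{c-1} = c`, Mathlib
`Real.hasDerivAt_rpow_const`, read as a one-sided slope limit). [folklore] -/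
theorem tendsto_slope_rpow_one (c : ℝ) :
    Tendsto (fun ρ : ℝ => (ρ ^ c - 1) / (ρ - 1)) (𝓝[<] 1) (𝓝 c) := by
  have hd : HasDerivAt (fun ρ : ℝ => ρ ^ c) (c * (1 : ℝ) ^ (c - 1)) 1 := Real.hasDerivAt_rpow_const (Or.inl one_ne_zero)
  rw [Real.one_rpow, mul_one] at hd
  have h := (hasDerivAt_iff_tendsto_slope_left_right.mp hd).1
  refine h.congr' ?_
  filter_upwards [self_mem_nhdsWithin] with ρ _
  rw [slope_def_field, Real.one_rpow]

/-- **The limit of the envelope**: for `a < b`, `(1 - ρ^a)/(ρ^a - ρ^b) → a/(b - a)` as `ρ → 1⁻` — both numerator and denominator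
vanish to first order, `1 - ρ^a = (1-ρ) S_a(ρ)`, `ρ^a - ρ^b = (1-ρ)(S_b(ρ) - S_a(ρ))` with the slopes of `tendsto_slope_rpow_one`.
[folklore] -/
theorem tendsto_envelope {a b : ℝ} (hab : a < b) :
    Tendsto (fun ρ : ℝ => (1 - ρ ^ a) / (ρ ^ a - ρ ^ b)) (𝓝[<] 1) (𝓝 (a / (b - a))) := by
  have Sa := tendsto_slope_rpow_one a
  have Sb := tendsto_slope_rpow_one b
  have h := Sa.div (Sb.sub Sa) (by linarith : b - a ≠ 0)
  refine h.congr' ?_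
  filter_upwards [Ioo_mem_nhdsLT zero_lt_one] with ρ hρ
  have hρ1 : ρ - 1 ≠ 0 := by linarith [hρ.2]
  have hρab : ρ ^ a - ρ ^ b ≠ 0 := by
    have := Real.rpow_lt_rpow_of_exponent_gt hρ.1 hρ.2 hab
    linarith
  have hden : (ρ ^ b - 1) / (ρ - 1) - (ρ ^ a - 1) / (ρ - 1) ≠ 0 := by
    rw [← sub_div, div_ne_zero_iff]
    exact ⟨by intro h0; apply hρab; linarith, hρ1⟩
  show (ρ ^ a - 1) / (ρ - 1) / ((ρ ^ b - 1) / (ρ - 1) - (ρ ^ a - 1) / (ρ - 1)) = (1 - ρ ^ a) / (ρ ^ a - ρ ^ b)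
  rw [← sub_div, div_div_div_cancel_right₀ hρ1]
  have hba : ρ ^ b - 1 - (ρ ^ a - 1) = -(ρ ^ a - ρ ^ b) := by ring
  rw [hba, div_neg, ← neg_div, neg_sub]

namespace CrossingData

variable {D : CrossingData} {s : ℝ}

/-! ### The crossing-symmetric value under a uniform lower bound -/

/-- **The envelope at every `ρ ∈ (0,1)`**: for unitary data solving the typed sum rule with all labels `≥ τ₀ > 2s`,
`G(½,½) ≤ 1 + (1 - ρ^{2s})/(ρ^{2s} - ρ^{τ₀})` for every `0 < ρ < 1` (monotonicity `G(½,½) ≤ G(y,y)` at `y = 1/(1+ρ) ∈ (½,1)` and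
gen 42's `fourPoint_diag_upper_closed`). [cite: RattazziEtAl2008, §3] -/
theorem fourPoint_half_le_envelope (hU : D.IsUnitary) (hC : D.SatisfiesCrossing s) {τ₀ : ℝ} (hτ : ∀ i, τ₀ ≤ D.Δ i)
    (hτ₀ : 2 * s < τ₀) {ρ : ℝ} (hρ : ρ ∈ Ioo (0 : ℝ) 1) :
    D.fourPoint (1 / 2) (1 / 2) ≤ 1 + (1 - ρ ^ (2 * s)) / (ρ ^ (2 * s) - ρ ^ τ₀) := by
  have hconv := opeConvergent_of_lowerBound hU hC hτ hτ₀
  have hρ1 : 0 < 1 + ρ := by linarith [hρ.1]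
  set y : ℝ := 1 / (1 + ρ) with hy
  have hy2 : 1 / 2 < y := by rw [hy, div_lt_div_iff₀ (by norm_num) hρ1]; linarith [hρ.2]
  have hy1 : y < 1 := by rw [hy, div_lt_one hρ1]; linarith [hρ.1]
  have hρy : (1 - y) / y = ρ := by rw [hy]; field_simp; ring
  have h1 := fourPoint_diag_upper_closed hU hC hτ hτ₀ hy2 hy1
  rw [hρy] at h1
  have h2 := fourPoint_mono hU hconv (z := 1 / 2) (zb := 1 / 2) (z' := y) (zb' := y) (by norm_num) (by norm_num)
    hy2.le hy2.le hy1 hy1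
  linarith

/-- **The crossing-symmetric value is bounded by the gap.** For every unitary solution of the typed `⟨σσσσ⟩` sum rule at `Δ_σ = s`
all of whose exchanged dimensions are `≥ τ₀ > 2s`: `G(½,½) ≤ τ₀/(τ₀ - 2s)` (= `1 + 2s/(τ₀ - 2s)`, the limit of the envelope of
`fourPoint_half_le_envelope` as `ρ → 1⁻`, `tendsto_envelope` + `ge_of_tendsto`). With `one_le_fourPoint`: `1 ≤ G(½,½) ≤ τ₀/(τ₀ - 2s)`.
[cite: RattazziEtAl2008, §3] -/
theorem fourPoint_half_le_of_lowerBound (hU : D.IsUnitary) (hC : D.SatisfiesCrossing s) {τ₀ : ℝ} (hτ : ∀ i, τ₀ ≤ D.Δ i)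
    (hτ₀ : 2 * s < τ₀) : D.fourPoint (1 / 2) (1 / 2) ≤ τ₀ / (τ₀ - 2 * s) := by
  have hT : Tendsto (fun ρ : ℝ => 1 + (1 - ρ ^ (2 * s)) / (ρ ^ (2 * s) - ρ ^ τ₀)) (𝓝[<] 1)
      (𝓝 (1 + 2 * s / (τ₀ - 2 * s))) := (tendsto_envelope hτ₀).const_add 1
  have hle : D.fourPoint (1 / 2) (1 / 2) ≤ 1 + 2 * s / (τ₀ - 2 * s) :=
    ge_of_tendsto hT (by
      filter_upwards [Ioo_mem_nhdsLT zero_lt_one] with ρ hρ using fourPoint_half_le_envelope hU hC hτ hτ₀ hρ)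
  have hne : τ₀ - 2 * s ≠ 0 := by linarith
  have heq : 1 + 2 * s / (τ₀ - 2 * s) = τ₀ / (τ₀ - 2 * s) := by field_simp; ring
  linarith [heq]

/-- **Scalar-gap branch**: `U > 2s`, `s < 1` (every label `≥ min U 2 > 2s`): `G(½,½) ≤ min U 2 / (min U 2 - 2s)`.
[cite: RattazziEtAl2008, §5] -/
theorem fourPoint_half_le_of_hasScalarGap (hU : D.IsUnitary) (hC : D.SatisfiesCrossing s) {U : ℝ} (hgap : D.HasScalarGap U)
    (hU2 : 2 * s < U) (hs1 : s < 1) : D.fourPoint (1 / 2) (1 / 2) ≤ min U 2 / (min U 2 - 2 * s) :=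
  fourPoint_half_le_of_lowerBound hU hC (lowerBound_of_hasScalarGap hU hgap) (lt_min hU2 (by linarith))

/-- **Single-location branch** (`ExcludedAt` / `TwoSided` / `ControlDataSet` data): scalars in `{x₀} ∪ [G,∞)`, `x₀, G > 2s`, `s < 1`:
`G(½,½) ≤ m/(m - 2s)` with `m = min (min x₀ G) 2`. [cite: RattazziEtAl2008, §5] -/
theorem fourPoint_half_le_of_location (hU : D.IsUnitary) (hC : D.SatisfiesCrossing s) {x₀ G : ℝ}
    (hS : D.ScalarsIn ({x₀} ∪ Ici G)) (hx : 2 * s < x₀) (hG : 2 * s < G) (hs1 : s < 1) :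
    D.fourPoint (1 / 2) (1 / 2) ≤ min (min x₀ G) 2 / (min (min x₀ G) 2 - 2 * s) :=
  fourPoint_half_le_of_lowerBound hU hC (lowerBound_of_location hU hS) (lt_min (lt_min hx hG) (by linarith))

/-! ### E.1n's constants made universal under a lower bound -/

/-- **Universal spectral-density bound under a gap**: for every unitary solution of the typed sum rule at `s > 0` with all labels
`≥ τ₀ > 2s` and every `E ≥ 2s`, `Σ'_{Δ_i ≤ E} p_i ≤ ½ · e^{2s} · (E/(2s))^{2s} · τ₀/(τ₀ - 2s)` — E.1n's `sum_p_low_le` with its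
constant `G(½,½)` replaced by `fourPoint_half_le_of_lowerBound`. [cite: PappadopuloRychkovEspinRattazzi2012PRD, §4.2] -/
theorem sum_p_low_le_of_lowerBound (hU : D.IsUnitary) (hC : D.SatisfiesCrossing s) (hs : 0 < s) {τ₀ : ℝ}
    (hτ : ∀ i, τ₀ ≤ D.Δ i) (hτ₀ : 2 * s < τ₀) {E : ℝ} (hE : 2 * s ≤ E) :
    ∑' i : ↥({i : D.ι | D.Δ i ≤ E} : Set D.ι), D.p i ≤
      1 / 2 * Real.exp (2 * s) * (E / (2 * s)) ^ (2 * s) * (τ₀ / (τ₀ - 2 * s)) := by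
  have h1 := sum_p_low_le hU hC hs hE
  have h2 := fourPoint_half_le_of_lowerBound hU hC hτ hτ₀
  have hA : 0 ≤ 1 / 2 * Real.exp (2 * s) * (E / (2 * s)) ^ (2 * s) := by
    have : 0 ≤ (E / (2 * s)) ^ (2 * s) := Real.rpow_nonneg (div_pos (by linarith) (by linarith)).le _
    positivity
  exact h1.trans (mul_le_mul_of_nonneg_left h2 hA)

/-- **Universal convergence rate under a gap**: `Σ'_{Δ_i ≥ E} p_i g_i(x₀,x₀) ≤ e^{2s} (E/(2s))^{2s} · τ₀/(τ₀ - 2s) · x₀^E` whenever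
`E ≥ 2s`, `E(1-x₀) ≥ 2s·x₀`. [cite: PappadopuloRychkovEspinRattazzi2012PRD, §4.4] -/
theorem tail_le_of_lowerBound (hU : D.IsUnitary) (hC : D.SatisfiesCrossing s) (hs : 0 < s) {τ₀ : ℝ} (hτ : ∀ i, τ₀ ≤ D.Δ i)
    (hτ₀ : 2 * s < τ₀) {x₀ E : ℝ} (hx₀ : 0 < x₀) (hE : 2 * s ≤ E) (hEx : 2 * s * x₀ ≤ E * (1 - x₀)) :
    ∑' i : ↥({i : D.ι | E ≤ D.Δ i} : Set D.ι), D.p i * globalBlock (D.Δ i) (D.spin i) x₀ x₀ ≤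
      Real.exp (2 * s) * (E / (2 * s)) ^ (2 * s) * (τ₀ / (τ₀ - 2 * s)) * x₀ ^ E := by
  have h1 := tail_le hU hC hs hx₀ hE hEx
  have h2 := fourPoint_half_le_of_lowerBound hU hC hτ hτ₀
  have hA : 0 ≤ Real.exp (2 * s) * (E / (2 * s)) ^ (2 * s) := by
    have : 0 ≤ (E / (2 * s)) ^ (2 * s) := Real.rpow_nonneg (div_pos (by linarith) (by linarith)).le _
    positivity
  have hx₀E : 0 ≤ x₀ ^ E := Real.rpow_nonneg hx₀.le E
  exact h1.trans (mul_le_mul_of_nonneg_right (mul_le_mul_of_nonneg_left h2 hA) hx₀E)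

/-- **A 2D-Ising-like gap**: at `s = 1/8`, every unitary solution of the typed sum rule all of whose labels have `Δ_i ≥ 1` satisfies
`G(½,½) ≤ 4/3` (`τ₀/(τ₀ - 2s)` at `τ₀ = 1`, `2s = 1/4`). A statement about the typed class under that gap hypothesis only. CONTROL-ONLY.
[folklore] -/
theorem fourPoint_half_le_ising_gap (hU : D.IsUnitary) (hC : D.SatisfiesCrossing (1 / 8)) (hτ : ∀ i, (1 : ℝ) ≤ D.Δ i) :
    D.fourPoint (1 / 2) (1 / 2) ≤ 4 / 3 := by
  have h := fourPoint_half_le_of_lowerBound hU hC hτ (by norm_num)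
  norm_num at h
  exact h

end CrossingData

/-! ### The record's class at `Δ_σ = 1/8` -/

/-- **The record's class at `Δ_σ = 1/8`: `G(½,½) ≤ 99/74`** (all labels `≥ 0.99` by `twoSided_2d_kernel099`; `0.99/(0.99 - 0.25) = 99/74`;
E.1n's `record_fourPoint_half_le` used the cruder `7/3`). CONTROL-ONLY; no certificate or number of the record is touched. [folklore] -/
theorem record_fourPoint_half_le_sharp (w : ℝ) (D : CrossingData) (hU : D.IsUnitary) (hC : D.SatisfiesCrossing (1 / 8))
    (hT : D.SpinTwoIn ({2} ∪ Ici (2 + 1))) (x : ℝ) (hwx : w ≤ x) (hS : D.ScalarsIn ({x} ∪ Ici 2)) :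
    D.fourPoint (1 / 2) (1 / 2) ≤ 99 / 74 := by
  have hx : (99 / 100 : ℝ) < x := ((twoSided_2d_kernel099 w) D hU hC hT x hwx hS).1
  have hτ : ∀ i, (99 / 100 : ℝ) ≤ D.Δ i := fun i =>
    le_trans (le_min (le_min hx.le (by norm_num)) (by norm_num)) (CrossingData.lowerBound_of_location hU hS i)
  have h := CrossingData.fourPoint_half_le_of_lowerBound hU hC hτ (by norm_num)
  norm_num at h
  exact h

/-- **The record's class at `Δ_σ = 1/8`: `Σ'_{Δ_i ≤ E} p_i ≤ (99/148) · e^{1/4} · (4E)^{1/4}`** for every `E ≥ 1/4` (E.1n's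
`record_sum_p_low_le` had `7/6`). CONTROL-ONLY. [folklore] -/
theorem record_sum_p_low_le_sharp (w : ℝ) (D : CrossingData) (hU : D.IsUnitary) (hC : D.SatisfiesCrossing (1 / 8))
    (hT : D.SpinTwoIn ({2} ∪ Ici (2 + 1))) (x : ℝ) (hwx : w ≤ x) (hS : D.ScalarsIn ({x} ∪ Ici 2)) {E : ℝ} (hE : 1 / 4 ≤ E) :
    ∑' i : ↥({i : D.ι | D.Δ i ≤ E} : Set D.ι), D.p i ≤ 99 / 148 * Real.exp (1 / 4) * (4 * E) ^ (1 / 4 : ℝ) := by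
  have h := CrossingData.sum_p_low_le hU hC (s := 1 / 8) (by norm_num) (E := E) (by linarith)
  have hG := record_fourPoint_half_le_sharp w D hU hC hT x hwx hS
  rw [show (2 * (1 / 8 : ℝ)) = 1 / 4 by norm_num, show E / (1 / 4 : ℝ) = 4 * E by ring] at h
  have hA : 0 ≤ 1 / 2 * Real.exp (1 / 4) * (4 * E) ^ (1 / 4 : ℝ) := by positivity
  calc ∑' i : ↥({i : D.ι | D.Δ i ≤ E} : Set D.ι), D.p i
      ≤ 1 / 2 * Real.exp (1 / 4) * (4 * E) ^ (1 / 4 : ℝ) * D.fourPoint (1 / 2) (1 / 2) := h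
    _ ≤ 1 / 2 * Real.exp (1 / 4) * (4 * E) ^ (1 / 4 : ℝ) * (99 / 74) := mul_le_mul_of_nonneg_left hG hA
    _ = _ := by ring

end Summit.CriticalPhenomena.Ising3D.Control2D
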